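import Summits.HodgeConjecture.HodgeConjecture.Theorems.VHCAbelianSchemesRoadSecantQuotientAnchorMarkman
import Literature.AlgebraicGeometry.Markman2025.SecantQuotientPolarization
import HarnessLib

/-!
# Road b02 (`VHCAbelianSchemesRoad`, D-0059) — the PINNED preprint input for skeleton v3.1 of crux `SemiregularSheafRepresentativesTwAtDiag`
# (item stmt-HodgeConjecture-19787): anchors polarised by the descended Weil polarisation `h_Y(θ₀)`, modulo the pinned identified claim

research route conditional on HC_CM; not a corollary; Q11.4-sentence-2 already refuted in dim ≥ 3.

THEOREMS ONLY (no definition, `HC_CM` nowhere, no statement of any item touched). Ring2 LEAD ruling L152.4c defers skeleton v3.1 — the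
NARROWING of the geometric anchor predicate `IsSecantQuotientWeilClassAt` (gap G2: «`θ` any ample-line polarisation class») to
«`θ = e^*h_Y(θ₀)` for a polarisation class `θ₀` of the theta divisor», `h_Y(θ₀) = Markman2025.secantPolarizationClass … d θ₀` the descent of
`Ξ_d(θ₀) = p₁^*θ₀ + d·p₂^*θ̂₀` (typer file `Markman2025/SecantQuotientPolarization.lean`, p507939) — until a PINNED preprint input exists, so
that «anchors inhabited» survives the narrowing. That input is `Literature.AlgebraicGeometry.HodgeTheory.Markman2025_secantQuotient_twistedCarrier_onJacobian_pinned`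
(appended to `HodgeTheory/SecantQuotientJacobianTwistedCarrier.lean`, p510628, seat b02 gen 88; ∃-form, PREPRINT/UNREFEREED; rendering: print's
anchor transported along the involution `σ̄` of `Y_d` — finding F7 —, its polarisation `σ̄^*h = h_Y(c·[Θ])`, `c ∈ ℚˣ`, by the rank-one
`Spin(V)_P`-invariant line, Cor. 3.2.3 and uniqueness of descent along `q^*`). This file converts it into the road's objects, ready for v3.1
under whatever names the LEAD lineage files:

* `secantQuotient_twistedCarrier_onJacobian_of_pinned` — the pinned claim implies the unpinned one (forget `θ₀`); hence everything of
  `…SecantQuotientAnchorMarkman` (anchor locus inhabited, (2a′) at print's anchor, constant pencil, P1) follows from the pinned claim too.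
* `exists_secantQuotientDatum_pinned_of_pinned` — for every even `d ≥ 4`: a `SecantQuotientDatum D` with `D.d = d`, a polarisation class `θ₀`
  OF `D.Θ` (`D.𝒥.J.IsPolarizationClassOf D.Θ θ₀`), the class `θ := secantPolarizationClass D.𝒥.J D.isAmple D.G₁ D.G₂ D.succ_ne_zero D.G₁_le
  D.G₂_le D.d θ₀` ON `D.Y.X` (= `D.hY θ₀` once the v3.1 Defs name it), a class `γ` with `IsSecantQuotientWeilClassAt D.Y.X θ γ` (v3's predicate,
  chart `Iso.refl`), the typer's envelope-with-class `Markman2025.IsSecantQuotientAnchorWith D.d D.Y.X θ`, and the pinned `Adm`-datum on every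
  copy of `D.Y.X` — i.e. the v3.1 anchor clause «`∃ θ₀, IsPolarizationClassOf D.Θ θ₀ ∧ θ = e^*(D.hY θ₀)`» is MET at `e = Iso.refl`, together
  with every v3 clause, modulo the pinned claim.

Nothing here says (2a′), (2b′), their v3.1 narrowings, the rung, the crux, any cell, K-SR♭∃, VHC, `HC_AV`, `HC_CM` or HC holds. References:
[cite: Markman2025SecantWeil, §1.3 (p. 5), §1.5 (p. 7), Thm. 1.4.1, Prop. 2.4.4, Cor. 3.2.3 and Lemma 3.1.3] [cite: Bloch1972Semiregularity, Remark (7.5)].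
-/

noncomputable section

open CategoryTheory CategoryTheory.Limits AlgebraicGeometry Topology

-- the cell's namespace repeats the summit name (`Summit.HodgeConjecture.HodgeConjecture…`), as in every `Ring2*` file
set_option linter.dupNamespace false

namespace Summit.HodgeConjecture.HodgeConjecture.Ring2.SemiregularRepresentatives

open Literature.AlgebraicGeometry Literature.AlgebraicGeometry.Motives
open Literature.AlgebraicGeometry.HodgeTheory Literature.AlgebraicGeometry.Markman2025
open Literature.AlgebraicTopology.SingularHomology

variable {C : ChernCharacterBetti} {Adm : PerfectAdmissibility}

/-- **The pinned identified claim implies the unpinned one** (forget the polarisation class `θ₀` of `Θ`): so every consequence drawn in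
`…SecantQuotientAnchorMarkman` from `Markman2025_secantQuotient_twistedCarrier_onJacobian` (anchor locus inhabited, (2a′) met at print's anchor,
the served constant pencil, P1) follows from `Markman2025_secantQuotient_twistedCarrier_onJacobian_pinned` as well. [cite: Markman2025SecantWeil, §1.5 (p. 7) and Cor. 3.2.3] -/
theorem secantQuotient_twistedCarrier_onJacobian_of_pinned (hM : Markman2025_secantQuotient_twistedCarrier_onJacobian_pinned C Adm) :
    Markman2025_secantQuotient_twistedCarrier_onJacobian C Adm := by
  intro d hd h4
  obtain ⟨Cᵥ, hC, 𝒥, hdimJ, Θ, hR, hP, G₁, G₂, h₁, h₂, hc₁, hn₁, hc₂, hn₂, hdisj, hgp, θ₀, γ, -, hpair⟩ := hM d hd h4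
  exact ⟨Cᵥ, hC, 𝒥, hdimJ, Θ, hR, hP, G₁, G₂, h₁, h₂, hc₁, hn₁, hc₂, hn₂, hdisj, hgp, _, γ, hpair⟩

/-- **FROM THE PINNED CLAIM TO THE v3.1 ANCHOR DATA.** For every even `d ≥ 4`: a `SecantQuotientDatum D` with `D.d = d`, a polarisation class
`θ₀` of `D.Θ`, the descended Weil polarisation `θ := secantPolarizationClass … D.d θ₀` on `D.Y.X` and a class `γ` such that `(D.Y.X, θ, γ)`
satisfies v3's `IsSecantQuotientWeilClassAt` (chart `Iso.refl`), `(D.Y.X, θ)` satisfies the typer's `Markman2025.IsSecantQuotientAnchorWith D.d`,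
and the pinned `Adm`-datum serving `(e^*θ, e^*γ)` exists on every copy `e : X' ≅ D.Y.X`. (Re-typing the claim's conclusion over `D`'s projections
first — `D.Y`, `D.P`, `D.ψ`, `D.q` then unfold to it in one step.) [cite: Markman2025SecantWeil, §1.3 (p. 5), §1.5 (p. 7), Cor. 3.2.3 and Lemma 3.1.3] -/
theorem exists_secantQuotientDatum_pinned_of_pinned (hM : Markman2025_secantQuotient_twistedCarrier_onJacobian_pinned C Adm)
    {d : ℕ} (hd : Even d) (h4 : 4 ≤ d) :
    ∃ (D : SecantQuotientDatum) (θ₀ : complexBetti D.𝒥.J.X 2) (γ : complexBetti D.Y.X (2 * 3)),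
      D.d = d ∧ D.𝒥.J.IsPolarizationClassOf D.Θ θ₀ ∧
      IsSecantQuotientWeilClassAt D.Y.X
        (secantPolarizationClass D.𝒥.J D.isAmple D.G₁ D.G₂ D.succ_ne_zero D.G₁_le D.G₂_le D.d θ₀) γ ∧
      IsSecantQuotientAnchorWith D.d D.Y.X
        (secantPolarizationClass D.𝒥.J D.isAmple D.G₁ D.G₂ D.succ_ne_zero D.G₁_le D.G₂_le D.d θ₀) ∧
      ∀ (X' : SchemeOver ℂ) (e : X' ≅ D.Y.X),
        ∃ (I : Finset ℕ) (κ : (k : ℕ) → complexBetti X' (2 * k)) (c : ℕ → ℂ),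
          3 ∈ I ∧ twistedReflexiveClass C Adm 6 X' I κ ∧
          κ 3 = complexBetti.map e.hom (2 * 3) γ +
            c 3 • cupPowTwo (complexBetti.map e.hom 2
              (secantPolarizationClass D.𝒥.J D.isAmple D.G₁ D.G₂ D.succ_ne_zero D.G₁_le D.G₂_le D.d θ₀)) 3 ∧
          ∀ k ∈ I, k ≠ 3 → κ k = c k • cupPowTwo (complexBetti.map e.hom 2
              (secantPolarizationClass D.𝒥.J D.isAmple D.G₁ D.G₂ D.succ_ne_zero D.G₁_le D.G₂_le D.d θ₀)) k := by
  obtain ⟨Cᵥ, hC, 𝒥, hdimJ, Θ, hR, hP, G₁, G₂, h₁, h₂, hc₁, hn₁, hc₂, hn₂, hdisj, hgp, h𝒯⟩ := hM d hd h4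
  let D : SecantQuotientDatum :=
    { d := d, C := Cᵥ, smooth := hC, 𝒥 := 𝒥, dim_J := hdimJ, Θ := Θ, riemann := hR, principal := hP, G₁ := G₁, G₂ := G₂,
      G₁_le := h₁, G₂_le := h₂, even := hd, four_le := h4, cyclic₁ := hc₁, card₁ := hn₁, cyclic₂ := hc₂, card₂ := hn₂,
      disjoint := hdisj, generalPosition := hgp }
  have hD : HasPinnedTwistedCarrierOnSecantQuotient C Adm D.𝒥.J D.isAmple D.KTheta_eq_bot D.G₁ D.G₂ D.succ_ne_zero
      D.G₁_le D.G₂_le D.d := h𝒯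
  obtain ⟨θ₀, γ, hθ₀, hpol, hamp, hhyp, hγQ, hγray, hγW, hcopy⟩ := hD
  have hid2 : complexBetti.map (Iso.refl D.Y.X).inv 2
      (secantPolarizationClass D.𝒥.J D.isAmple D.G₁ D.G₂ D.succ_ne_zero D.G₁_le D.G₂_le D.d θ₀) =
        secantPolarizationClass D.𝒥.J D.isAmple D.G₁ D.G₂ D.succ_ne_zero D.G₁_le D.G₂_le D.d θ₀ := by
    rw [Iso.refl_inv, complexBetti.map_id]; rfl
  have hid6 : complexBetti.map (Iso.refl D.Y.X).inv (2 * 3) γ = γ := by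
    rw [Iso.refl_inv, complexBetti.map_id]; rfl
  refine ⟨D, θ₀, γ, rfl, hθ₀, ⟨D, Iso.refl _, hpol, ?_, ?_, hγQ, hγray, ?_⟩, ?_, hcopy⟩
  · rw [hid2]; exact hamp
  · rw [hid2]; exact hhyp
  · rw [hid6]; exact hγW
  · -- the typer's envelope-with-class at the identity chart (anonymous constructor; the chart equation is `map (𝟙 _) = id`;
    -- `show` first unfolds `D.Y` so that the identity's source and target agree syntactically for `complexBetti.map_id`)
    show IsSecantQuotientAnchorWith D.d (secantQuotient D.𝒥.J D.isAmple D.G₁ D.G₂ D.succ_ne_zero D.G₁_le D.G₂_le).X _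
    refine ⟨D.C, D.smooth, D.𝒥, D.dim_J, D.Θ, D.riemann, D.principal, θ₀, hθ₀, D.G₁, D.G₂, D.G₁_le, D.G₂_le,
      D.cyclic₁, D.card₁, D.cyclic₂, D.card₂, D.disjoint, Iso.refl _, ?_⟩
    rw [Iso.refl_hom, complexBetti.map_id]; rfl

/-- **Hence the v3.1 anchor locus is NOT EMPTY and (2a′)'s v3.1 narrowing is MET at print's anchor, modulo the pinned claim** — the pinned
analogue of `not_forall_not_secantQuotientAnchors_of_onJacobian`: some `(X, θ)` with `θ` the descended Weil polarisation of a polarisation class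
of the theta divisor is a secant–quotient anchor in the typer's sense `IsSecantQuotientAnchorWith` AND in v3's sense, with a served class.
[cite: Markman2025SecantWeil, §1.3 (p. 5), §1.5 (p. 7) and Cor. 3.2.3] -/
theorem exists_isSecantQuotientAnchorWith_served_of_pinned (hM : Markman2025_secantQuotient_twistedCarrier_onJacobian_pinned C Adm) :
    ∃ (d : ℕ) (X : SchemeOver ℂ) (θ : complexBetti X 2) (γ : complexBetti X (2 * 3)),
      Even d ∧ 4 ≤ d ∧ IsSecantQuotientAnchorWith d X θ ∧ IsSecantQuotientWeilClassAt X θ γ := by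
  obtain ⟨D, θ₀, γ, hD4, -, hW, hA, -⟩ := exists_secantQuotientDatum_pinned_of_pinned hM (by decide : Even 4) le_rfl
  exact ⟨D.d, D.Y.X, _, γ, hD4 ▸ (by decide : Even 4), hD4 ▸ le_rfl, hA, hW⟩

end Summit.HodgeConjecture.HodgeConjecture.Ring2.SemiregularRepresentatives

end
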